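import Literature.MathematicalPhysics.QuantumLattice.HubbardTTPrimeThermalPressureDensity
import Mathlib.Analysis.Convex.Deriv
import HarnessLib

/-!
# Density anchors for the thermal pressure of the 2D `t–t'` Hubbard model: secant ceilings, endpoint floors,
# supporting lines

Topic `MathematicalPhysics/QuantumLattice` (family `hubbard`); consumer forms of the concavity
`concaveOn_pressureTT'_density` (`HubbardTTPrimeThermalPressureDensity.lean`) for the density leg of the positive-
temperature box words (`p = pressureTT' β t t' U`, `β ≥ 0`, `U ≥ 0`, densities in `[0, 2)`):

* `pressureTT'_le_secant_right` / `_left` — three anchors: for `x₀ < x₁ < n` (or `n < x₁ < x₀`)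
  `p(n) ≤ p(x₁) + (p(x₁) − p(x₀))/(x₁ − x₀) · (n − x₁)` (secant extrapolation of a concave function is a CEILING);
* `pressureTT'_le_of_anchor_ceiling_floor_right` / `_left` — the certificate form: a certified CEILING `p(x₁) ≤ c₁`
  and a certified FLOOR `f₀ ≤ p(x₀)` give `p(n) ≤ c₁ + (c₁ − f₀)/(x₁ − x₀) · (n − x₁)` beyond `x₁`;
* `le_pressureTT'_of_endpoint_floors` — certified floors at the two endpoints of a filling interval bind the
  interval: `min f_x f_y ≤ p(n)` for `x ≤ n ≤ y`;
* `exists_supporting_line_pressureTT'` — at every interior density `0 < ρ < 2` there is a slope `s` (a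
  `β`-scaled chemical potential) with `p(x) ≤ p(ρ) + s (x − ρ)` on `[0, 2)`.

Everything is PROVED; no definition, no named fact. (Ruelle 1969 §3.4; the `T = 0` twins are
`energyDensityTT'_tPrime_le_extrapolate_right/left` and `exists_supporting_line_energyDensityTT'`.)

## Mathlib / tree search

REUSED: `concaveOn_pressureTT'_density`, `min_pressureTT'_le_of_mem_Icc` (`HubbardTTPrimeThermalPressureDensity`),
Mathlib `ConcaveOn.slope_anti`, `ConcaveOn.neg`, `ConvexOn.slope_le_leftDeriv_of_mem_interior`,
`ConvexOn.leftDeriv_le_rightDeriv_of_mem_interior`, `ConvexOn.rightDeriv_le_slope_of_mem_interior`.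

## References

* D. Ruelle, *Statistical Mechanics: Rigorous Results* (1969), §3.4. [cite: Ruelle1969, §3.4]
-/

noncomputable section

namespace Literature.MathematicalPhysics.QuantumLattice

open _root_.Filter
open scoped _root_.Topology

namespace ThermodynamicLimit

variable {β : ℝ} (hβ : 0 ≤ β) (t t' : ℝ) {U : ℝ} (hU : 0 ≤ U)
include hβ hU

/-- **Secant ceiling to the right**: for `0 ≤ x₀ < x₁ < n < 2`,
`p(n) ≤ p(x₁) + (p(x₁) − p(x₀))/(x₁ − x₀) · (n − x₁)`. [cite: Ruelle1969, §3.4] -/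
theorem pressureTT'_le_secant_right {x₀ x₁ n : ℝ} (hx0 : 0 ≤ x₀) (h01 : x₀ < x₁) (h1n : x₁ < n) (hn2 : n < 2) :
    pressureTT' β t t' U n ≤ pressureTT' β t t' U x₁ +
      (pressureTT' β t t' U x₁ - pressureTT' β t t' U x₀) / (x₁ - x₀) * (n - x₁) := by
  have hc := concaveOn_pressureTT'_density hβ t t' hU
  have hx1 : x₁ ∈ Set.Ico (0 : ℝ) 2 := ⟨hx0.trans h01.le, h1n.trans hn2⟩
  have h := hc.slope_anti hx1 (a := x₀) (b := n) ⟨⟨hx0, h01.trans (h1n.trans hn2)⟩, fun h => absurd h h01.ne⟩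
    ⟨⟨(hx0.trans h01.le).trans h1n.le, hn2⟩, fun h => absurd h h1n.ne'⟩ (h01.trans h1n).le
  rw [slope_def_field, slope_def_field, div_le_iff₀ (sub_pos.2 h1n)] at h
  have e : (pressureTT' β t t' U x₀ - pressureTT' β t t' U x₁) / (x₀ - x₁) =
      (pressureTT' β t t' U x₁ - pressureTT' β t t' U x₀) / (x₁ - x₀) := by
    rw [← neg_sub, ← neg_sub x₁ x₀, neg_div_neg_eq]
  rw [e] at h
  linarith

/-- **Secant ceiling to the left**: for `0 ≤ n < x₁ < x₀ < 2`,
`p(n) ≤ p(x₁) + (p(x₁) − p(x₀))/(x₁ − x₀) · (n − x₁)`. [cite: Ruelle1969, §3.4] -/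
theorem pressureTT'_le_secant_left {x₀ x₁ n : ℝ} (hn0 : 0 ≤ n) (hn1 : n < x₁) (h10 : x₁ < x₀) (hx2 : x₀ < 2) :
    pressureTT' β t t' U n ≤ pressureTT' β t t' U x₁ +
      (pressureTT' β t t' U x₁ - pressureTT' β t t' U x₀) / (x₁ - x₀) * (n - x₁) := by
  have hc := concaveOn_pressureTT'_density hβ t t' hU
  have hx1 : x₁ ∈ Set.Ico (0 : ℝ) 2 := ⟨hn0.trans hn1.le, h10.trans hx2⟩
  have h := hc.slope_anti hx1 (a := n) (b := x₀) ⟨⟨hn0, hn1.trans (h10.trans hx2)⟩, fun h => absurd h hn1.ne⟩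
    ⟨⟨(hn0.trans hn1.le).trans h10.le, hx2⟩, fun h => absurd h h10.ne'⟩ (hn1.trans h10).le
  rw [slope_def_field, slope_def_field, le_div_iff_of_neg (sub_neg.2 hn1)] at h
  have e : (pressureTT' β t t' U x₀ - pressureTT' β t t' U x₁) / (x₀ - x₁) =
      (pressureTT' β t t' U x₁ - pressureTT' β t t' U x₀) / (x₁ - x₀) := by
    rw [← neg_sub, ← neg_sub x₁ x₀, neg_div_neg_eq]
  rw [e] at h
  linarith

/-- **Box-word ceiling from two certificates (right)**: a certified ceiling `p(x₁) ≤ c₁` and a certified floor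
`f₀ ≤ p(x₀)` at densities `0 ≤ x₀ < x₁` bound the pressure at every `n ∈ (x₁, 2)` above:
`p(n) ≤ c₁ + (c₁ − f₀)/(x₁ − x₀) · (n − x₁)`. [cite: Ruelle1969, §3.4] -/
theorem pressureTT'_le_of_anchor_ceiling_floor_right {x₀ x₁ n c₁ f₀ : ℝ} (hx0 : 0 ≤ x₀) (h01 : x₀ < x₁)
    (h1n : x₁ < n) (hn2 : n < 2) (hc : pressureTT' β t t' U x₁ ≤ c₁) (hf : f₀ ≤ pressureTT' β t t' U x₀) :
    pressureTT' β t t' U n ≤ c₁ + (c₁ - f₀) / (x₁ - x₀) * (n - x₁) := by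
  have h := pressureTT'_le_secant_right hβ t t' hU hx0 h01 h1n hn2
  have hd : 0 < x₁ - x₀ := sub_pos.2 h01
  have hmono : (pressureTT' β t t' U x₁ - pressureTT' β t t' U x₀) / (x₁ - x₀) * (n - x₁) ≤
      (c₁ - f₀) / (x₁ - x₀) * (n - x₁) := by
    refine mul_le_mul_of_nonneg_right ?_ (sub_nonneg.2 h1n.le)
    exact div_le_div_of_nonneg_right (by linarith) hd.le
  linarith

/-- **Box-word ceiling from two certificates (left)**: a certified ceiling `p(x₁) ≤ c₁` and a certified floor
`f₀ ≤ p(x₀)` at densities `x₁ < x₀ < 2` bound the pressure at every `n ∈ [0, x₁)` above: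
`p(n) ≤ c₁ + (c₁ − f₀)/(x₀ − x₁) · (x₁ − n)`. [cite: Ruelle1969, §3.4] -/
theorem pressureTT'_le_of_anchor_ceiling_floor_left {x₀ x₁ n c₁ f₀ : ℝ} (hn0 : 0 ≤ n) (hn1 : n < x₁)
    (h10 : x₁ < x₀) (hx2 : x₀ < 2) (hc : pressureTT' β t t' U x₁ ≤ c₁) (hf : f₀ ≤ pressureTT' β t t' U x₀) :
    pressureTT' β t t' U n ≤ c₁ + (c₁ - f₀) / (x₀ - x₁) * (x₁ - n) := by
  have h := pressureTT'_le_secant_left hβ t t' hU hn0 hn1 h10 hx2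
  have hd : 0 < x₀ - x₁ := sub_pos.2 h10
  have e : (pressureTT' β t t' U x₁ - pressureTT' β t t' U x₀) / (x₁ - x₀) * (n - x₁) =
      (pressureTT' β t t' U x₁ - pressureTT' β t t' U x₀) / (x₀ - x₁) * (x₁ - n) := by
    rw [← neg_sub x₀ x₁, ← neg_sub x₁ n, div_neg, neg_mul_neg]
  rw [e] at h
  have hmono : (pressureTT' β t t' U x₁ - pressureTT' β t t' U x₀) / (x₀ - x₁) * (x₁ - n) ≤
      (c₁ - f₀) / (x₀ - x₁) * (x₁ - n) := by
    refine mul_le_mul_of_nonneg_right ?_ (sub_nonneg.2 hn1.le)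
    exact div_le_div_of_nonneg_right (by linarith) hd.le
  linarith

/-- **Box-word floor from two certificates**: certified floors `f_x ≤ p(x)`, `f_y ≤ p(y)` at the endpoints of a
filling interval `0 ≤ x ≤ n ≤ y < 2` give `min f_x f_y ≤ p(n)`. [cite: Ruelle1969, §3.4] -/
theorem le_pressureTT'_of_endpoint_floors {x n y fx fy : ℝ} (hx0 : 0 ≤ x) (hxn : x ≤ n) (hny : n ≤ y) (hy2 : y < 2)
    (hfx : fx ≤ pressureTT' β t t' U x) (hfy : fy ≤ pressureTT' β t t' U y) :
    min fx fy ≤ pressureTT' β t t' U n :=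
  (min_le_min hfx hfy).trans (min_pressureTT'_le_of_mem_Icc hβ t t' hU hx0 hxn hny hy2)

/-- **Supporting line (supergradient) of the concave pressure**: for every interior density `0 < ρ < 2` there is a
slope `s` with `p(x) ≤ p(ρ) + s (x − ρ)` for all `x ∈ [0, 2)` (`s` = minus the right derivative of `−p` at `ρ`; at
`β > 0`, `s/β` is a chemical potential of the density `ρ`). [cite: Ruelle1969, §3.4] -/
theorem exists_supporting_line_pressureTT' {ρ : ℝ} (hρ0 : 0 < ρ) (hρ2 : ρ < 2) :
    ∃ s : ℝ, ∀ x ∈ Set.Ico (0 : ℝ) 2, pressureTT' β t t' U x ≤ pressureTT' β t t' U ρ + s * (x - ρ) := by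
  have hfc : ConvexOn ℝ (Set.Ico (0 : ℝ) 2) (-pressureTT' β t t' U) := (concaveOn_pressureTT'_density hβ t t' hU).neg
  have hρint : ρ ∈ interior (Set.Ico (0 : ℝ) 2) := by rw [interior_Ico]; exact ⟨hρ0, hρ2⟩
  refine ⟨-derivWithin (-pressureTT' β t t' U) (Set.Ioi ρ) ρ, fun x hx => ?_⟩
  rcases lt_trichotomy x ρ with hlt | rfl | hgt
  · have h1 := hfc.slope_le_leftDeriv_of_mem_interior hx hρint hlt
    have h2 := hfc.leftDeriv_le_rightDeriv_of_mem_interior hρint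
    have h := h1.trans h2
    rw [slope_def_field, div_le_iff₀ (by linarith)] at h
    simp only [Pi.neg_apply] at h
    linarith
  · simp
  · have h := hfc.rightDeriv_le_slope_of_mem_interior hρint (hx : x ∈ Set.Ico (0 : ℝ) 2) hgt
    rw [slope_def_field, le_div_iff₀ (by linarith)] at h
    simp only [Pi.neg_apply] at h
    linarith

end ThermodynamicLimit

end Literature.MathematicalPhysics.QuantumLattice
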